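import Summits.CriticalPhenomena.PercolationContinuityZ3.Theorems.PercNearOneGluingNoHeavyLowerTailCoreConditioning
import Summits.CriticalPhenomena.PercolationContinuityZ3.Theorems.PercNearOneGluingNoHeavyLowerTailCoreAttractionSep
import HarnessLib

/-!
# `NoHeavyLowerTail` (stmt-CriticalPhenomena-4575) — core repulsion given a separation

Support file (prover `prim-lf-1`, lemma factory #1; `--supports stmt-CriticalPhenomena-4575`).  No definitions,
no named facts, no sorries.  Companion of `…CoreAttractionSep.lean`.

Random-core ("floating sink") calculus: `μ = prodBernoulli w`, core `R` with anchor `c`, `Γ = ⋂_{r∈R} {c ↔ r}`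
("the core is internally connected"), vertices `o, a, b`, `D = {a ↮ b}`.  In the seat memo's 3×3 o/core table given
`D ∩ Γ` (CANDIDATES.md BATCH 8; rows `o ∈ C_b` / `o ∉ C_b`, columns `R ⊆ C_b` / core free / `R ⊆ C_a`) the theorem
below is the minor `D(o: B<NA; R: BF<A)`:
  `μ(D ∩ {o↔b} ∩ {R ⊆ C_a}) · μ(D ∩ Γ ∩ {o↮b} ∩ {a↮c}) ≤ μ(D ∩ Γ ∩ {o↔b} ∩ {a↮c}) · μ(D ∩ {o↮b} ∩ {R ⊆ C_a})`
("given `a ↮ b` and a connected core, `{o ∈ C_b}` and `{R ⊆ C_a}` are negatively correlated").  With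
`coreAttraction_sep` (the minor `D(o: B<NA; R: B<FA)`) it gives the one-sided odds shift (T3) of
`…CoreExchangeOddsShift.lean`, hence the random-core pair exchange RC1 (assembled in `…CoreExchangeSettled.lean`).
Proof = the device of van den Berg–Häggström–Kahn's proof of their Thm. 1.5 with the two clusters' roles swapped
relative to `coreAttraction_sep`: condition on `U = C_a`; on `{a ↮ b}` the rest is percolation off `Ū`, so
`P(o↔b | C_a = U) = φ(U)` and `P(Γ, R ∩ C_a = ∅ | C_a = U) = ρ(U)` are DECREASING in `U`, `1{R ⊆ C_a}` is increasing,
and `P(o↔b, Γ, R ∩ C_a = ∅ | C_a = U) ≥ φ(U) ρ(U)` (Harris in the fresh variables); BHK's Thm. 1.3 (tree fact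
`BHK2006_clusterConditionalPositiveAssociation_holds`) twice; conditioning via `CoreConditioning.sum_cond_cluster_off`.
-/

noncomputable section

namespace Summit.CriticalPhenomena.PercolationContinuityZ3.Theorems

open MeasureTheory Set Literature.Probability.LatticeModels Literature.Probability.Percolation
open BHK2006 DecisionTree TwoAvoidanceSets CoreAttraction CoreAttractionSep CoreConditioning
open scoped Classical BigOperators

namespace CoreRepulsionSep

variable {V : Type*} [Fintype V]

/-- **Core repulsion given `{a ↮ b}`** (random-core row "(β)" = the table minor `D(o: B<NA; R: BF<A)` of the
seat memo CANDIDATES.md BATCH 8/10).  With `D = {a ↮ b}` and `Γ = ⋂_{r ∈ R} {c ↔ r}`: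
`μ(D ∩ ({o↔b} ∩ ⋂_{r∈R}{a↔r})) · μ(D ∩ (Γ ∩ {o↮b} ∩ {a↮c})) ≤ μ(D ∩ (Γ ∩ {o↔b} ∩ {a↮c})) · μ(D ∩ ({o↮b} ∩ ⋂_{r∈R}{a↔r}))`
— given the separation of `a` from `b`, the events "`o` joins `b`" and "`a`'s cluster swallows the core" are
negatively correlated relative to the column "core connected and free of `C_a`".  Proof: condition on `C_a`;
BHK Thm. 1.3 (tree fact `BHK2006_clusterConditionalPositiveAssociation_holds`) twice, Harris in the fresh
variables, and `sum_cond_cluster_off`. [this file] -/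
theorem coreRepulsion_sep (w : Sym2 V → unitInterval) (o a b c : V) (R : Finset V) :
    (prodBernoulli w).real ((openConn a b : Set (BondConfig V))ᶜ ∩
        ((openConn o b : Set (BondConfig V)) ∩ ⋂ r ∈ R, openConn a r)) *
        (prodBernoulli w).real ((openConn a b : Set (BondConfig V))ᶜ ∩
          ((⋂ r ∈ R, (openConn c r : Set (BondConfig V))) ∩ (openConn o b)ᶜ ∩ (openConn a c)ᶜ)) ≤
      (prodBernoulli w).real ((openConn a b : Set (BondConfig V))ᶜ ∩
          ((⋂ r ∈ R, (openConn c r : Set (BondConfig V))) ∩ openConn o b ∩ (openConn a c)ᶜ)) *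
        (prodBernoulli w).real ((openConn a b : Set (BondConfig V))ᶜ ∩
          ((openConn o b : Set (BondConfig V))ᶜ ∩ ⋂ r ∈ R, openConn a r)) := by
  classical
  -- degenerate case `a = b`: `{a ↮ a} = ∅`
  by_cases hab : a = b
  · subst hab
    have hc : ((openConn a a : Set (BondConfig V))ᶜ) = ∅ := by
      ext ω
      simp only [Set.mem_compl_iff, Set.mem_empty_iff_false, iff_false, not_not]
      exact SimpleGraph.Reachable.refl a
    simp [hc]
  set w' : Sym2 V → ℝ := fun e => (w e : ℝ) with hw'
  have hw0 : ∀ e, 0 ≤ w' e := fun e => (w e).2.1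
  have hw1 : ∀ e, w' e ≤ 1 := fun e => (w e).2.2
  have hm : ∑ ω, weight w' ω = 1 := by
    have h1 := integral_prodBernoulli_eq_sum w fun _ => (1 : ℝ)
    simp only [integral_const, probReal_univ, smul_eq_mul, mul_one] at h1
    exact h1.symm
  set Γ : Set (BondConfig V) := ⋂ r ∈ R, (openConn c r : Set (BondConfig V)) with hΓ
  set Ob : Set (BondConfig V) := openConn o b with hOb
  set HA : Set (BondConfig V) := ⋂ r ∈ R, (openConn a r : Set (BondConfig V)) with hHA
  set Dc : Set (BondConfig V) := (openConn a c : Set (BondConfig V))ᶜ with hDc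
  set Da : Set (BondConfig V) := {ω : BondConfig V | ∀ x ∈ ({b} : Set V), ¬ (openGraph ω).Reachable a x}
    with hDa
  have hDa' : ((openConn a b : Set (BondConfig V))ᶜ) = Da := by
    ext ω; simp only [hDa, Set.mem_setOf_eq, Set.mem_singleton_iff, forall_eq, Set.mem_compl_iff]; rfl
  have hmemDa : ∀ ω, ω ∈ Da ↔ ¬ (openGraph ω).Reachable a b := fun ω => by
    simp only [hDa, Set.mem_setOf_eq, Set.mem_singleton_iff, forall_eq]
  have hanb : a ∉ ({b} : Set V) := fun h => hab (Set.mem_singleton_iff.1 h)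
  rw [hDa']
  -- functions of the edge cluster `U = C_a`, and of the fresh clusters `C_b`, `C_c`
  let gb : Set (Sym2 V) → ℝ := fun U => if b = a ∨ ∃ e ∈ U, b ∈ e then 0 else 1
  let gc : Set (Sym2 V) → ℝ := fun U => if c = a ∨ ∃ e ∈ U, c ∈ e then 0 else 1
  let hR : Set (Sym2 V) → ℝ := fun U => if ∀ r ∈ R, r = a ∨ ∃ e ∈ U, r ∈ e then 1 else 0
  let fo : Set (Sym2 V) → ℝ := fun E => if o = b ∨ ∃ e ∈ E, o ∈ e then 1 else 0
  let G : Set (Sym2 V) → ℝ := fun E => if ∀ r ∈ R, r = c ∨ ∃ e ∈ E, r ∈ e then 1 else 0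
  let Abar : Set (Sym2 V) → Set (Sym2 V) := fun U => {e | ∃ v ∈ e, v = a ∨ ∃ e' ∈ U, v ∈ e'}
  let φ : Set (Sym2 V) → ℝ := fun U => ∑ η, weight w' η * fo (openEdgeCluster (η \ Abar U) b)
  let ρ : Set (Sym2 V) → ℝ := fun U => ∑ η, weight w' η * G (openEdgeCluster (η \ Abar U) c)
  let χ : Set (Sym2 V) → ℝ := fun U =>
    ∑ η, weight w' η * (G (openEdgeCluster (η \ Abar U) c) * fo (openEdgeCluster (η \ Abar U) b))
  let ρg : Set (Sym2 V) → ℝ := fun U => ρ U * gc U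
  let χg : Set (Sym2 V) → ℝ := fun U => χ U * gc U
  have hfo0 : ∀ E, 0 ≤ fo E := fun E => by simp only [fo]; split_ifs <;> norm_num
  have hfo1 : ∀ E, fo E ≤ 1 := fun E => by simp only [fo]; split_ifs <;> norm_num
  have hG0 : ∀ E, 0 ≤ G E := fun E => by simp only [G]; split_ifs <;> norm_num
  have hG1 : ∀ E, G E ≤ 1 := fun E => by simp only [G]; split_ifs <;> norm_num
  have hgc0 : ∀ U, 0 ≤ gc U := fun U => by simp only [gc]; split_ifs <;> norm_num
  have hgc1 : ∀ U, gc U ≤ 1 := fun U => by simp only [gc]; split_ifs <;> norm_num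
  have hhR0 : ∀ U, 0 ≤ hR U := fun U => by simp only [hR]; split_ifs <;> norm_num
  have hhR1 : ∀ U, hR U ≤ 1 := fun U => by simp only [hR]; split_ifs <;> norm_num
  have hGmono : Monotone G := monotone_FO c R
  have hhR_mono : Monotone hR := monotone_FO a R
  have hfo_mono : Monotone fo := by
    intro W W' h
    simp only [fo]
    by_cases hW : o = b ∨ ∃ e ∈ W, o ∈ e
    · rw [if_pos hW, if_pos (hW.imp id fun ⟨e, he, hoe⟩ => ⟨e, h he, hoe⟩)]
    · rw [if_neg hW]; split_ifs <;> norm_num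
  have hgc_anti : Antitone gc := by
    intro W W' h
    simp only [gc]
    by_cases hW : c = a ∨ ∃ e ∈ W, c ∈ e
    · rw [if_pos hW, if_pos (hW.imp id fun ⟨e, he, hce⟩ => ⟨e, h he, hce⟩)]
    · rw [if_neg hW]; split_ifs <;> norm_num
  have hAbar_mono : Monotone Abar := bar_mono a
  have hsd : ∀ {U U' : Set (Sym2 V)}, U ≤ U' → ∀ η : Set (Sym2 V), η \ Abar U' ⊆ η \ Abar U :=
    fun h η => Set.sdiff_subset_sdiff_right (hAbar_mono h)
  have hφ0 : ∀ U, 0 ≤ φ U := fun U =>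
    Finset.sum_nonneg fun η _ => mul_nonneg (weight_nonneg hw0 hw1 η) (hfo0 _)
  have hφ1 : ∀ U, φ U ≤ 1 := fun U => by
    calc φ U ≤ ∑ η, weight w' η * 1 :=
          Finset.sum_le_sum fun η _ => mul_le_mul_of_nonneg_left (hfo1 _) (weight_nonneg hw0 hw1 η)
      _ = 1 := by simp [hm]
  have hρ0 : ∀ U, 0 ≤ ρ U := fun U =>
    Finset.sum_nonneg fun η _ => mul_nonneg (weight_nonneg hw0 hw1 η) (hG0 _)
  have hχ0 : ∀ U, 0 ≤ χ U := fun U =>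
    Finset.sum_nonneg fun η _ => mul_nonneg (weight_nonneg hw0 hw1 η) (mul_nonneg (hG0 _) (hfo0 _))
  have hφ_anti : Antitone φ := by
    intro U U' h
    refine Finset.sum_le_sum fun η _ => mul_le_mul_of_nonneg_left ?_ (weight_nonneg hw0 hw1 η)
    exact hfo_mono (openEdgeCluster_mono (hsd h η) b)
  have hρ_anti : Antitone ρ := by
    intro U U' h
    refine Finset.sum_le_sum fun η _ => mul_le_mul_of_nonneg_left ?_ (weight_nonneg hw0 hw1 η)
    exact hGmono (openEdgeCluster_mono (hsd h η) c)
  have hρg_anti : Antitone ρg := fun U U' h =>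
    mul_le_mul (hρ_anti h) (hgc_anti h) (hgc0 _) (hρ0 _)
  have hρg0 : ∀ U, 0 ≤ ρg U := fun U => mul_nonneg (hρ0 U) (hgc0 U)
  -- Harris in the fresh variables: `χ ≥ ρ · φ`
  have hχ_ge : ∀ U, ρ U * φ U ≤ χ U := by
    intro U
    have h := harris hw0 hw1 (w := w') (f := fun η => G (openEdgeCluster (η \ Abar U) c))
      (g := fun η => fo (openEdgeCluster (η \ Abar U) b)) (fun η => hG0 _) (fun η => hfo0 _)
      (fun η η' hle => hGmono (openEdgeCluster_mono (Set.sdiff_subset_sdiff_left hle) c))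
      (fun η η' hle => hfo_mono (openEdgeCluster_mono (Set.sdiff_subset_sdiff_left hle) b))
    rw [hm, one_mul] at h
    exact h
  have hgb : ∀ ω : Set (Sym2 V), gb (openEdgeCluster ω a) = ind Da ω := by
    intro ω
    have : (b = a ∨ ∃ e ∈ openEdgeCluster ω a, b ∈ e) ↔ (openGraph ω).Reachable a b := by
      rw [← reachable_iff_exists_mem_openEdgeCluster]
    by_cases h : (openGraph ω).Reachable a b
    · rw [show gb (openEdgeCluster ω a) = 0 from if_pos (this.2 h), ind_of_not_mem (fun h' => (hmemDa ω).1 h' h)]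
    · rw [show gb (openEdgeCluster ω a) = 1 from if_neg (fun h' => h (this.1 h')), ind_of_mem ((hmemDa ω).2 h)]
  have hgc' : ∀ ω : Set (Sym2 V), gc (openEdgeCluster ω a) = ind Dc ω := by
    intro ω
    have : (c = a ∨ ∃ e ∈ openEdgeCluster ω a, c ∈ e) ↔ (openGraph ω).Reachable a c := by
      rw [← reachable_iff_exists_mem_openEdgeCluster]
    by_cases h : (openGraph ω).Reachable a c
    · have hn : ω ∉ Dc := fun h' => h' h
      rw [show gc (openEdgeCluster ω a) = 0 from if_pos (this.2 h), ind_of_not_mem hn]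
    · have hy : ω ∈ Dc := h
      rw [show gc (openEdgeCluster ω a) = 1 from if_neg (fun h' => h (this.1 h')), ind_of_mem hy]
  have hhR' : ∀ ω : Set (Sym2 V), hR (openEdgeCluster ω a) = ind HA ω := by
    intro ω
    have : (∀ r ∈ R, r = a ∨ ∃ e ∈ openEdgeCluster ω a, r ∈ e) ↔ ω ∈ HA := by
      simp only [hHA, Set.mem_iInter]
      refine forall₂_congr fun r _ => ?_
      rw [← reachable_iff_exists_mem_openEdgeCluster]; rfl
    by_cases h : ω ∈ HA
    · simp only [hR, if_pos (this.2 h), ind_of_mem h]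
    · simp only [hR, if_neg (fun h' => h (this.1 h')), ind_of_not_mem h]
  have hfo' : ∀ ω : Set (Sym2 V), fo (openEdgeCluster ω b) = ind Ob ω := by
    intro ω
    have : (o = b ∨ ∃ e ∈ openEdgeCluster ω b, o ∈ e) ↔ ω ∈ Ob := by
      rw [← reachable_iff_exists_mem_openEdgeCluster]
      exact ⟨fun h => h.symm, fun h => (show (openGraph ω).Reachable o b from h).symm⟩
    by_cases h : ω ∈ Ob
    · simp only [fo, if_pos (this.2 h), ind_of_mem h]
    · simp only [fo, if_neg (fun h' => h (this.1 h')), ind_of_not_mem h]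
  have hG' : ∀ ω : Set (Sym2 V), G (openEdgeCluster ω c) = ind Γ ω := by
    intro ω
    have : (∀ r ∈ R, r = c ∨ ∃ e ∈ openEdgeCluster ω c, r ∈ e) ↔ ω ∈ Γ := by
      simp only [hΓ, Set.mem_iInter]
      refine forall₂_congr fun r _ => ?_
      rw [← reachable_iff_exists_mem_openEdgeCluster]; rfl
    by_cases h : ω ∈ Γ
    · simp only [G, if_pos (this.2 h), ind_of_mem h]
    · simp only [G, if_neg (fun h' => h (this.1 h')), ind_of_not_mem h]
  -- on `{a ↮ b}` (resp. `{a ↮ c}`) the cluster of `b` (resp. `c`) lives in the fresh variables off `Ā`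
  have hfresh_b : ∀ ω : Set (Sym2 V), ω ∈ Da →
      openEdgeCluster ω b = openEdgeCluster (ω \ Abar (openEdgeCluster ω a)) b := by
    intro ω hω
    refine openEdgeCluster_eq_sdiff_bar rfl fun h => (hmemDa ω).1 hω ?_
    exact (reachable_iff_exists_mem_openEdgeCluster ω a b).2 h
  have hfresh_c : ∀ ω : Set (Sym2 V), ω ∈ Dc →
      openEdgeCluster ω c = openEdgeCluster (ω \ Abar (openEdgeCluster ω a)) c := by
    intro ω hω
    refine openEdgeCluster_eq_sdiff_bar rfl fun h => hω ?_
    exact (reachable_iff_exists_mem_openEdgeCluster ω a c).2 h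
  -- the four measures as sums over `ω` of functions of `C_a`
  have e1 : (prodBernoulli w).real (Da ∩ (Ob ∩ HA)) =
      ∑ ω, weight w' ω * (hR (openEdgeCluster ω a) * φ (openEdgeCluster ω a) * ind Da ω) := by
    rw [real_eq_sum_ind]
    have key := sum_cond_cluster_off w' hm a (fun U ζ => gb U * hR U * fo (openEdgeCluster ζ b))
    have lhs : ∀ ω : Set (Sym2 V), ind (Da ∩ (Ob ∩ HA)) ω =
        gb (openEdgeCluster ω a) * hR (openEdgeCluster ω a) *
          fo (openEdgeCluster (ω \ Abar (openEdgeCluster ω a)) b) := by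
      intro ω
      by_cases hω : ω ∈ Da
      · rw [← hfresh_b ω hω, hfo', hgb, hhR', ind_inter, ind_inter]; ring
      · have h0 : gb (openEdgeCluster ω a) = 0 := by rw [hgb, ind_of_not_mem hω]
        rw [h0, ind_of_not_mem (fun h => hω h.1)]; ring
    have rhs : ∀ ω : Set (Sym2 V), (∑ η, weight w' η * (gb (openEdgeCluster ω a) * hR (openEdgeCluster ω a) *
        fo (openEdgeCluster (η \ Abar (openEdgeCluster ω a)) b))) =
        hR (openEdgeCluster ω a) * φ (openEdgeCluster ω a) * ind Da ω := by
      intro ω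
      rw [← hgb]
      simp only [φ, Finset.mul_sum, Finset.sum_mul]
      exact Finset.sum_congr rfl fun η _ => by ring
    simp only [lhs]
    rw [key]
    exact Finset.sum_congr rfl fun ω _ => by rw [rhs]
  -- (2) `μ(D ∩ (Obᶜ ∩ HA)) = Σ weight · hR(C_a) (1 - φ(C_a)) 1_D`
  have e2 : (prodBernoulli w).real (Da ∩ (Obᶜ ∩ HA)) =
      ∑ ω, weight w' ω * (hR (openEdgeCluster ω a) * (1 - φ (openEdgeCluster ω a)) * ind Da ω) := by
    rw [real_eq_sum_ind]
    have key := sum_cond_cluster_off w' hm a (fun U ζ => gb U * hR U * (1 - fo (openEdgeCluster ζ b)))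
    have lhs : ∀ ω : Set (Sym2 V), ind (Da ∩ (Obᶜ ∩ HA)) ω =
        gb (openEdgeCluster ω a) * hR (openEdgeCluster ω a) *
          (1 - fo (openEdgeCluster (ω \ Abar (openEdgeCluster ω a)) b)) := by
      intro ω
      by_cases hω : ω ∈ Da
      · rw [← hfresh_b ω hω, hfo', hgb, hhR', ind_inter, ind_compl_inter]; ring
      · have h0 : gb (openEdgeCluster ω a) = 0 := by rw [hgb, ind_of_not_mem hω]
        rw [h0, ind_of_not_mem (fun h => hω h.1)]; ring
    have rhs : ∀ ω : Set (Sym2 V), (∑ η, weight w' η * (gb (openEdgeCluster ω a) * hR (openEdgeCluster ω a) *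
        (1 - fo (openEdgeCluster (η \ Abar (openEdgeCluster ω a)) b)))) =
        hR (openEdgeCluster ω a) * (1 - φ (openEdgeCluster ω a)) * ind Da ω := by
      intro ω
      rw [← hgb]
      have hsplit : ∑ η, weight w' η * (gb (openEdgeCluster ω a) * hR (openEdgeCluster ω a) *
          (1 - fo (openEdgeCluster (η \ Abar (openEdgeCluster ω a)) b))) =
          gb (openEdgeCluster ω a) * hR (openEdgeCluster ω a) * (∑ η, weight w' η) -
            gb (openEdgeCluster ω a) * hR (openEdgeCluster ω a) * φ (openEdgeCluster ω a) := by
        simp only [φ, Finset.mul_sum, ← Finset.sum_sub_distrib]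
        exact Finset.sum_congr rfl fun η _ => by ring
      rw [hsplit, hm]; ring
    simp only [lhs]
    rw [key]
    exact Finset.sum_congr rfl fun ω _ => by rw [rhs]
  -- (3) `μ(D ∩ (Γ ∩ Ob ∩ Dc)) = Σ weight · χg(C_a) 1_D`
  have e3 : (prodBernoulli w).real (Da ∩ (Γ ∩ Ob ∩ Dc)) =
      ∑ ω, weight w' ω * (χg (openEdgeCluster ω a) * ind Da ω) := by
    rw [real_eq_sum_ind]
    have key := sum_cond_cluster_off w' hm a
      (fun U ζ => gb U * gc U * (G (openEdgeCluster ζ c) * fo (openEdgeCluster ζ b)))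
    have lhs : ∀ ω : Set (Sym2 V), ind (Da ∩ (Γ ∩ Ob ∩ Dc)) ω =
        gb (openEdgeCluster ω a) * gc (openEdgeCluster ω a) *
          (G (openEdgeCluster (ω \ Abar (openEdgeCluster ω a)) c) *
            fo (openEdgeCluster (ω \ Abar (openEdgeCluster ω a)) b)) := by
      intro ω
      by_cases hω : ω ∈ Da
      · by_cases hω' : ω ∈ Dc
        · rw [← hfresh_b ω hω, ← hfresh_c ω hω', hfo', hG', hgb, hgc', ind_inter, ind_inter, ind_inter]; ring
        · have h0 : gc (openEdgeCluster ω a) = 0 := by rw [hgc', ind_of_not_mem hω']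
          rw [h0, ind_of_not_mem (fun h => hω' h.2.2)]; ring
      · have h0 : gb (openEdgeCluster ω a) = 0 := by rw [hgb, ind_of_not_mem hω]
        rw [h0, ind_of_not_mem (fun h => hω h.1)]; ring
    have rhs : ∀ ω : Set (Sym2 V), (∑ η, weight w' η * (gb (openEdgeCluster ω a) * gc (openEdgeCluster ω a) *
        (G (openEdgeCluster (η \ Abar (openEdgeCluster ω a)) c) *
          fo (openEdgeCluster (η \ Abar (openEdgeCluster ω a)) b)))) =
        χg (openEdgeCluster ω a) * ind Da ω := by
      intro ω
      rw [← hgb]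
      simp only [χg, χ, Finset.sum_mul]
      exact Finset.sum_congr rfl fun η _ => by ring
    simp only [lhs]
    rw [key]
    exact Finset.sum_congr rfl fun ω _ => by rw [rhs]
  -- (4) `μ(D ∩ (Γ ∩ Obᶜ ∩ Dc)) = Σ weight · (ρg(C_a) - χg(C_a)) 1_D`
  have e4 : (prodBernoulli w).real (Da ∩ (Γ ∩ Obᶜ ∩ Dc)) =
      ∑ ω, weight w' ω * ((ρg (openEdgeCluster ω a) - χg (openEdgeCluster ω a)) * ind Da ω) := by
    rw [real_eq_sum_ind]
    have key := sum_cond_cluster_off w' hm a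
      (fun U ζ => gb U * gc U * (G (openEdgeCluster ζ c) * (1 - fo (openEdgeCluster ζ b))))
    have lhs : ∀ ω : Set (Sym2 V), ind (Da ∩ (Γ ∩ Obᶜ ∩ Dc)) ω =
        gb (openEdgeCluster ω a) * gc (openEdgeCluster ω a) *
          (G (openEdgeCluster (ω \ Abar (openEdgeCluster ω a)) c) *
            (1 - fo (openEdgeCluster (ω \ Abar (openEdgeCluster ω a)) b))) := by
      intro ω
      by_cases hω : ω ∈ Da
      · by_cases hω' : ω ∈ Dc
        · rw [← hfresh_b ω hω, ← hfresh_c ω hω', hfo', hG', hgb, hgc', ind_inter, ind_inter,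
            show Γ ∩ Obᶜ = Obᶜ ∩ Γ from Set.inter_comm _ _, ind_compl_inter]
          ring
        · have h0 : gc (openEdgeCluster ω a) = 0 := by rw [hgc', ind_of_not_mem hω']
          rw [h0, ind_of_not_mem (fun h => hω' h.2.2)]; ring
      · have h0 : gb (openEdgeCluster ω a) = 0 := by rw [hgb, ind_of_not_mem hω]
        rw [h0, ind_of_not_mem (fun h => hω h.1)]; ring
    have rhs : ∀ ω : Set (Sym2 V), (∑ η, weight w' η * (gb (openEdgeCluster ω a) * gc (openEdgeCluster ω a) *
        (G (openEdgeCluster (η \ Abar (openEdgeCluster ω a)) c) *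
          (1 - fo (openEdgeCluster (η \ Abar (openEdgeCluster ω a)) b))))) =
        (ρg (openEdgeCluster ω a) - χg (openEdgeCluster ω a)) * ind Da ω := by
      intro ω
      rw [← hgb]
      simp only [ρg, χg, ρ, χ, Finset.sum_mul, ← Finset.sum_sub_distrib]
      exact Finset.sum_congr rfl fun η _ => by ring
    simp only [lhs]
    rw [key]
    exact Finset.sum_congr rfl fun ω _ => by rw [rhs]
  -- BHK Thm. 1.3 for `C_a` given `{a ↮ b}`: (i) `hR` increasing vs `φ` decreasing; (ii) `ρg`, `φ` both decreasing
  have cpa1 := BHK2006_clusterConditionalPositiveAssociation.antitone_right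
    BHK2006_clusterConditionalPositiveAssociation_holds V w a ({b} : Set V) hR φ hhR_mono hφ_anti hanb
  have cpa2 := BHK2006_clusterConditionalPositiveAssociation_holds V w a ({b} : Set V)
    (fun U => -ρg U) (fun U => -φ U) (fun U U' h => neg_le_neg (hρg_anti h))
    (fun U U' h => neg_le_neg (hφ_anti h)) hanb
  rw [← hDa] at cpa1 cpa2
  simp only [setIntegral_eq_sum_ind] at cpa1 cpa2
  rw [real_eq_sum_ind] at cpa1 cpa2
  set Sα := ∑ ω, weight w' ω * ind Da ω with hSα
  set SH := ∑ ω, weight w' ω * (hR (openEdgeCluster ω a) * ind Da ω) with hSH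
  set Sφ := ∑ ω, weight w' ω * (φ (openEdgeCluster ω a) * ind Da ω) with hSφ
  set SHφ := ∑ ω, weight w' ω * (hR (openEdgeCluster ω a) * φ (openEdgeCluster ω a) * ind Da ω) with hSHφ
  set Sρ := ∑ ω, weight w' ω * (ρg (openEdgeCluster ω a) * ind Da ω) with hSρ
  set Sρφ := ∑ ω, weight w' ω * (ρg (openEdgeCluster ω a) * φ (openEdgeCluster ω a) * ind Da ω) with hSρφ
  set Sχ := ∑ ω, weight w' ω * (χg (openEdgeCluster ω a) * ind Da ω) with hSχ
  have c1 : Sα * SHφ ≤ SH * Sφ := cpa1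
  -- `cpa2 : Sρ * Sφ ≤ Sα * Sρφ` (after removing the signs)
  have eρ : ∑ ω, weight w' ω * (-ρg (openEdgeCluster ω a) * ind Da ω) = -Sρ := by
    rw [hSρ, ← Finset.sum_neg_distrib]
    exact Finset.sum_congr rfl fun ω _ => by ring
  have eφ : ∑ ω, weight w' ω * (-φ (openEdgeCluster ω a) * ind Da ω) = -Sφ := by
    rw [hSφ, ← Finset.sum_neg_distrib]
    exact Finset.sum_congr rfl fun ω _ => by ring
  have eρφ : ∑ ω, weight w' ω * (-ρg (openEdgeCluster ω a) * -φ (openEdgeCluster ω a) * ind Da ω) = Sρφ := by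
    rw [hSρφ]
    exact Finset.sum_congr rfl fun ω _ => by ring
  rw [eρ, eφ, eρφ] at cpa2
  have c2 : Sρ * Sφ ≤ Sα * Sρφ := by rw [neg_mul_neg] at cpa2; exact cpa2
  -- (iii) `Sρφ ≤ Sχ` termwise (Harris in the fresh variables)
  have c3 : Sρφ ≤ Sχ := by
    refine Finset.sum_le_sum fun ω _ => mul_le_mul_of_nonneg_left ?_ (weight_nonneg hw0 hw1 ω)
    refine mul_le_mul_of_nonneg_right ?_ (ind_nonneg _ _)
    have := hχ_ge (openEdgeCluster ω a)
    show ρ (openEdgeCluster ω a) * gc (openEdgeCluster ω a) * φ (openEdgeCluster ω a) ≤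
      χ (openEdgeCluster ω a) * gc (openEdgeCluster ω a)
    calc ρ (openEdgeCluster ω a) * gc (openEdgeCluster ω a) * φ (openEdgeCluster ω a)
        = (ρ (openEdgeCluster ω a) * φ (openEdgeCluster ω a)) * gc (openEdgeCluster ω a) := by ring
      _ ≤ χ (openEdgeCluster ω a) * gc (openEdgeCluster ω a) :=
        mul_le_mul_of_nonneg_right this (hgc0 _)
  have lin2 : ∑ ω, weight w' ω * (hR (openEdgeCluster ω a) * (1 - φ (openEdgeCluster ω a)) * ind Da ω)
      = SH - SHφ := by
    rw [hSH, hSHφ, ← Finset.sum_sub_distrib]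
    exact Finset.sum_congr rfl fun ω _ => by ring
  have lin4 : ∑ ω, weight w' ω * ((ρg (openEdgeCluster ω a) - χg (openEdgeCluster ω a)) * ind Da ω)
      = Sρ - Sχ := by
    rw [hSρ, hSχ, ← Finset.sum_sub_distrib]
    exact Finset.sum_congr rfl fun ω _ => by ring
  rw [e1, e2, e3, e4, lin2, lin4]
  have hSα0 : 0 ≤ Sα := Finset.sum_nonneg fun ω _ => mul_nonneg (weight_nonneg hw0 hw1 ω) (ind_nonneg _ _)
  have hSH0 : 0 ≤ SH := Finset.sum_nonneg fun ω _ =>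
    mul_nonneg (weight_nonneg hw0 hw1 ω) (mul_nonneg (hhR0 _) (ind_nonneg _ _))
  have hSφ0 : 0 ≤ Sφ := Finset.sum_nonneg fun ω _ =>
    mul_nonneg (weight_nonneg hw0 hw1 ω) (mul_nonneg (hφ0 _) (ind_nonneg _ _))
  have hSHφ0 : 0 ≤ SHφ := Finset.sum_nonneg fun ω _ =>
    mul_nonneg (weight_nonneg hw0 hw1 ω) (mul_nonneg (mul_nonneg (hhR0 _) (hφ0 _)) (ind_nonneg _ _))
  have hSρ0 : 0 ≤ Sρ := Finset.sum_nonneg fun ω _ =>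
    mul_nonneg (weight_nonneg hw0 hw1 ω) (mul_nonneg (hρg0 _) (ind_nonneg _ _))
  have hSχ0 : 0 ≤ Sχ := Finset.sum_nonneg fun ω _ =>
    mul_nonneg (weight_nonneg hw0 hw1 ω) (mul_nonneg (mul_nonneg (hχ0 _) (hgc0 _)) (ind_nonneg _ _))
  have hSHφ_le : SHφ ≤ Sα := by
    refine Finset.sum_le_sum fun ω _ => mul_le_mul_of_nonneg_left ?_ (weight_nonneg hw0 hw1 ω)
    calc hR (openEdgeCluster ω a) * φ (openEdgeCluster ω a) * ind Da ω
        ≤ 1 * 1 * ind Da ω := by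
          refine mul_le_mul_of_nonneg_right (mul_le_mul (hhR1 _) (hφ1 _) (hφ0 _) zero_le_one) (ind_nonneg _ _)
      _ = ind Da ω := by ring
  -- conclude: `SHφ · Sρ ≤ Sχ · SH`
  have main : SHφ * Sρ ≤ Sχ * SH := by
    by_cases hα : Sα = 0
    · have h1 : SHφ = 0 := le_antisymm (hα ▸ hSHφ_le) hSHφ0
      rw [h1, zero_mul]; exact mul_nonneg hSχ0 hSH0
    · have hαpos : 0 < Sα := lt_of_le_of_ne hSα0 (Ne.symm hα)
      have k1 : Sα * SHφ * Sρ ≤ SH * Sφ * Sρ := mul_le_mul_of_nonneg_right c1 hSρ0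
      have k2 : SH * (Sρ * Sφ) ≤ SH * (Sα * Sρφ) := mul_le_mul_of_nonneg_left c2 hSH0
      have k3 : SH * (Sα * Sρφ) ≤ SH * (Sα * Sχ) :=
        mul_le_mul_of_nonneg_left (mul_le_mul_of_nonneg_left c3 hSα0) hSH0
      have k4 : Sα * (SHφ * Sρ) ≤ Sα * (Sχ * SH) := by linarith [k1, k2, k3]
      exact le_of_mul_le_mul_left k4 hαpos
  linarith [main]

end CoreRepulsionSep

end Summit.CriticalPhenomena.PercolationContinuityZ3.Theorems

end
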